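import Literature.ComputerArithmetic.Shewchuk1997.Compress
import Literature.ComputerArithmetic.RumpZimmermannBoldoMelquiond2009.PredSucc
import Mathlib.Tactic.Linarith
import Mathlib.Tactic.Positivity
import Mathlib.Tactic.Ring
import Mathlib.Tactic.NormNum

/-!
# COMPRESS under ties-to-away: a fixed point with relative error `> 2^-p` in EVERY precision
# (new work; the `p`-indexed family behind the `p = 3` counterexample)

New work of the certified-arithmetic venture (ENGINES group: shared numerical engines serving
client cells; rigour lives in the verifiers; every published number belongs to a client cell's
ledger, not to the engines group).  NEGATIVE knowledge for the line "sharp error of the largest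
component of COMPRESS" [Shewchuk1997, §2.7 Theorem 23 and the conjecture on p. 333].

Companion file `CompressRelativeErrorTiesAway.lean` checks ONE instance (`p = 3`): under IEEE 754-2008
roundTiesToAway the nonoverlapping expansion `⟨−7, −112, −1024, 10240⟩` is returned unchanged by
COMPRESS although its largest component carries a RELATIVE error `1143/9097 > 1/8 = 2^-p`, so the
relative-error reading of Shewchuk's p.333 conjecture (`|h − hₙ| < 2^-p·|h|`, the supremum over his
family `1 + ε + ε² + ⋯`) fails for that tie rule.  THIS FILE proves the phenomenon in EVERY precision
`p ≥ 2` (so also for binary32/binary64 operated with roundTiesToAway): with `Y = 2^(p−1)`, any scale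
`2^e₀`, `e₀ ≥ emin`, and

  `a = −(2Y − 1)·2^e₀`,  `b = −(2Y − 1)·4Y·2^e₀`,  `c = −16Y³·2^e₀`,  `d = (32Y⁴ + 32Y³)·2^e₀`

(`p = 3`, `e₀ = 0`: `⟨−7, −112, −1024, 10240⟩`), every round-to-nearest `fl` on `F(p, emin)` with the
ties-to-away attribute satisfies `compress fl [a, b, c, d] = [a, b, c, d]`, and
`|(a + b + c + d) − d| / |a + b + c + d| > 2^-p` (`compress_relative_error_tiesAway_all_prec`).
The four numbers are floats and form a nonoverlapping expansion (`tiesAway_family_isFloat`,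
`tiesAway_family_isExpansion`), so the hypotheses of Theorem 23 are met.

MECHANISM (three rounding facts, the rest of both traversals is exact): `d = (2^(p−1) + 1)·u` sits just
above the power of two `2^(p−1)·u` (`u = 32Y³·2^e₀ = ulp d`); the carry `c = −u/2` makes `d + c` the
MIDPOINT of `d − u` and `d`, which ties-to-away resolves upwards to `d` (the only place the tie rule
is consulted); below, `b` is within less than half a grid step of `c` and `a` within less than half a
grid step of `b`, on the side AWAY from zero, so `fl(c + b) = c` and `fl(b + a) = b` for every nearest
rounding (floats beyond `|c|`, resp. `|b|`, lie on the grid `16Y²·2^e₀`, resp. `4Y·2^e₀`: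
`exists_eq_int_mul_two_zpow_of_isFloat`).  The relative error is
`(16Y³ + 8Y² − 2Y − 1)/(32Y⁴ + 16Y³ − 8Y² + 2Y + 1) > 1/(2Y)` because `4Y² − 4Y − 1 > 0` for `Y ≥ 2`.

HONEST FRAMING.  Shewchuk's sentence concerns his own arithmetic (IEEE double with round-to-EVEN);
under round-to-even the midpoint `d + c` goes DOWN to the even neighbour `d − u` and the example
re-associates — nothing here refutes the conjecture for round-to-even, which stays OPEN (not claimed
either way; likewise ties-to-zero).  What is shown: the relative reading is not a theorem about
round-to-nearest with an arbitrary fixed tie rule, in any precision; the tree's sharp bound for the top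
component is therefore stated in ulps (`CompressSharpStair.lean`, `CompressCarryBound.lean`,
`CompressTopError.lean`: `|Σ e − hₙ| ≤ ulp(hₙ)/2 · (1 + ε + ⋯ + ε^(k−1))`, attained).
-/

namespace Summit.Ventures.CertifiedArithmetic.Expansions

open Literature.ComputerArithmetic.JeannerodRump2018
open Literature.ComputerArithmetic.BoldoJeannerodMelquiondMuller2023 hiding twoSum twoSum_fst
open Literature.ComputerArithmetic.RumpOgitaOishi2008 (IsSucc)
open Literature.ComputerArithmetic.RumpZimmermannBoldoMelquiond2009 (IsTiesAway
  fl_midpoint_of_tiesAway_nonneg)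
open Literature.ComputerArithmetic.Shewchuk1997

variable {p : ℕ} {emin : ℤ} {fl : ℚ → ℚ}

/-! ### Generic lemmas: replaying COMPRESS on four components; roundings next to a grid -/

/-- COMPRESS on `[a, b, c, d]` (smallest first) returns its input whenever the three sums of adjacent
components round back to the larger one (`fl(d + c) = d`, `fl(c + b) = c`, `fl(b + a) = b`), the
components are floats (`fl x = x`) and the lower three are nonzero: both traversals then meet exactly
these three sums, FAST-TWO-SUM's correction steps are `fl 0 = 0` and `fl x = x`, and every roundoff
is the smaller addend itself. [cite: Shewchuk1997, §2.7 p. 332 (COMPRESS), §2.3 Theorem 6 (FAST-TWO-SUM)] -/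
theorem compress_eq_self_of_roundings {fl : ℚ → ℚ} {a b c d : ℚ} (h0 : fl 0 = 0) (ha : fl a = a)
    (hb : fl b = b) (hc : fl c = c) (hdc : fl (d + c) = d) (hcb : fl (c + b) = c)
    (hba : fl (b + a) = b) (ha0 : a ≠ 0) (hb0 : b ≠ 0) (hc0 : c ≠ 0) :
    compress fl [a, b, c, d] = [a, b, c, d] := by
  simp [compress, compressDown, compressUp, fastTwoSum, h0, ha, hb, hc, hdc, hcb, hba, ha0, hb0, hc0]

/-- Rounding next to a grid, negative side.  If the float `a = n·2^k ≤ −2^E` (`k = E − p + 1`, so that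
every float of magnitude `≥ 2^E` is a multiple of `2^k`) and `t ≤ a` lies within LESS than half a grid
step of `a`, then every round-to-nearest map gives `fl t = a`: a float below `a` is `≤ a − 2^k`, hence
farther from `t`; a float above `a` is farther from `t` than `a` trivially.
[cite: BoldoEtAl2023, §2.1 (p. 214: a float of magnitude ≥ 2^E is a multiple of 2^(E−p+1)), §2.2 (RN)] -/
private theorem fl_eq_of_grid (hfl : IsRoundNearest p emin fl) {t a : ℚ} {E k : ℤ}
    (hk : E - p + 1 = k) (ha : IsFloat p emin a) (hna : ∃ n : ℤ, a = n * (2 : ℚ) ^ k)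
    (haE : a ≤ -(2 : ℚ) ^ E) (hta : t ≤ a) (hclose : a - t < (2 : ℚ) ^ k / 2) : fl t = a := by
  have hF := (hfl t).1
  have hnear := (hfl t).2 a ha
  have hg : (0 : ℚ) < (2 : ℚ) ^ k := zpow_pos (by norm_num) _
  have h2E : (0 : ℚ) < (2 : ℚ) ^ E := zpow_pos (by norm_num) _
  rw [abs_of_nonpos (by linarith : t - a ≤ 0)] at hnear
  rcases lt_trichotomy (fl t) a with hlt | heq | hgt
  · exfalso
    have hE : (2 : ℚ) ^ E ≤ |fl t| := by rw [abs_of_neg (by linarith)]; linarith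
    obtain ⟨m, hm⟩ := exists_eq_int_mul_two_zpow_of_isFloat hF hE
    rw [hk] at hm
    obtain ⟨n, hn⟩ := hna
    have hmn : m < n := by
      have : (m : ℚ) * 2 ^ k < n * 2 ^ k := by rw [← hm, ← hn]; exact hlt
      exact_mod_cast lt_of_mul_lt_mul_right this hg.le
    have hm1 : (m : ℚ) + 1 ≤ n := by exact_mod_cast Int.add_one_le_iff.mpr hmn
    have hle : fl t ≤ a - 2 ^ k := by rw [hm, hn]; nlinarith
    rw [abs_of_nonneg (by linarith : 0 ≤ t - fl t)] at hnear
    linarith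
  · exact heq
  · exfalso
    rw [abs_of_nonpos (by linarith : t - fl t ≤ 0)] at hnear
    linarith

/-- Successor on a grid, positive side: if `f = n·2^k ≥ 2^E` (`k = E − p + 1`) and `f + 2^k` is a float,
then `succ(f) = f + 2^k` (every float `> f` is a multiple of `2^k`).
[cite: BoldoEtAl2023, §2.1 (p. 214); RumpOgitaOishi2008, §2 (succ)] -/
private theorem isSucc_of_grid {f : ℚ} {E k : ℤ} (hk : E - p + 1 = k)
    (hfg : IsFloat p emin (f + (2 : ℚ) ^ k)) (hnf : ∃ n : ℤ, f = n * (2 : ℚ) ^ k)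
    (hfE : (2 : ℚ) ^ E ≤ f) : IsSucc p emin f (f + (2 : ℚ) ^ k) := by
  have hg : (0 : ℚ) < (2 : ℚ) ^ k := zpow_pos (by norm_num) _
  refine ⟨hfg, by linarith, fun h hh hfh => ?_⟩
  have hE : (2 : ℚ) ^ E ≤ |h| := le_trans (by linarith) (le_abs_self h)
  obtain ⟨m, hm⟩ := exists_eq_int_mul_two_zpow_of_isFloat hh hE
  rw [hk] at hm
  obtain ⟨n, hn⟩ := hnf
  have h1 : n < m := by
    have : (n : ℚ) * 2 ^ k < m * 2 ^ k := by rw [← hm, ← hn]; exact hfh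
    exact_mod_cast lt_of_mul_lt_mul_right this hg.le
  have h2 : (n : ℚ) + 1 ≤ m := by exact_mod_cast Int.add_one_le_iff.mpr h1
  rw [hm, hn]
  nlinarith

/-- `2^(e₀ + n) = 2^n · 2^e₀` for a natural `n` (bookkeeping between the integer exponent of the scale
and the natural exponents of the significands). [cite: BoldoEtAl2023, §2.1] -/
private theorem two_zpow_add_nat (e₀ : ℤ) (n : ℕ) :
    (2 : ℚ) ^ (e₀ + (n : ℤ)) = 2 ^ n * (2 : ℚ) ^ e₀ := by
  rw [zpow_add₀ (by norm_num : (2 : ℚ) ≠ 0), zpow_natCast]; ring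

/-! ### The family -/

/-- The four components are floats of `F(p, emin)` (`p ≥ 2`, `e₀ ≥ emin`): significands `−(2^p − 1)`,
`−(2^p − 1)`, `−1`, `2^(p−1) + 1` with exponents `e₀`, `e₀ + p + 1`, `e₀ + 3p + 1`, `e₀ + 3p + 2`.
[cite: Shewchuk1997, §2.1 p. 309; JeannerodRump2018, §1 (F)] -/
theorem tiesAway_family_isFloat (hp : 2 ≤ p) {e₀ : ℤ} (he : emin ≤ e₀) {a b c d : ℚ}
    (ha : a = -(2 ^ p - 1) * 2 ^ e₀) (hb : b = -((2 ^ p - 1) * 2 ^ (p + 1)) * 2 ^ e₀)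
    (hc : c = -2 ^ (3 * p + 1) * 2 ^ e₀) (hd : d = (2 ^ p + 2) * 2 ^ (3 * p + 1) * 2 ^ e₀) :
    IsFloat p emin a ∧ IsFloat p emin b ∧ IsFloat p emin c ∧ IsFloat p emin d := by
  obtain ⟨q, rfl⟩ : ∃ q, p = q + 1 := ⟨p - 1, by omega⟩
  have hq : 1 ≤ q := by omega
  have hYle : (2 : ℤ) ≤ 2 ^ q := by
    calc (2 : ℤ) = 2 ^ 1 := (pow_one 2).symm
      _ ≤ 2 ^ q := pow_le_pow_right₀ (by norm_num) hq
  have hM : |(-(2 ^ (q + 1) - 1) : ℤ)| < 2 ^ (q + 1) := by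
    rw [abs_of_nonpos (by rw [pow_succ]; linarith), pow_succ]; linarith
  refine ⟨⟨-(2 ^ (q + 1) - 1), e₀, hM, he, by rw [ha]; push_cast; ring⟩,
    ⟨-(2 ^ (q + 1) - 1), e₀ + ((q + 2 : ℕ) : ℤ), hM, by push_cast; omega, ?_⟩,
    ⟨-1, e₀ + ((3 * q + 4 : ℕ) : ℤ), by rw [abs_neg, abs_one, pow_succ]; linarith,
      by push_cast; omega, ?_⟩,
    ⟨2 ^ q + 1, e₀ + ((3 * q + 5 : ℕ) : ℤ), by rw [abs_of_pos (by positivity), pow_succ]; linarith,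
      by push_cast; omega, ?_⟩⟩
  · rw [hb, two_zpow_add_nat]; push_cast; ring
  · rw [hc, two_zpow_add_nat]; push_cast; ring
  · rw [hd, two_zpow_add_nat]; push_cast; ring

/-- The four components form a nonoverlapping expansion, smallest first (`IsExpansion 1`): `b`, `c`, `d`
are multiples of `4Y·2^e₀`, `16Y³·2^e₀`, `32Y³·2^e₀` (`Y = 2^(p−1)`) and everything below them is
smaller in magnitude than that grid step. [cite: Shewchuk1997, §2.1 p. 309 (nonoverlapping)] -/
theorem tiesAway_family_isExpansion (hp : 2 ≤ p) (e₀ : ℤ) {a b c d : ℚ}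
    (ha : a = -(2 ^ p - 1) * 2 ^ e₀) (hb : b = -((2 ^ p - 1) * 2 ^ (p + 1)) * 2 ^ e₀)
    (hc : c = -2 ^ (3 * p + 1) * 2 ^ e₀) (hd : d = (2 ^ p + 2) * 2 ^ (3 * p + 1) * 2 ^ e₀) :
    IsExpansion 1 [a, b, c, d] := by
  obtain ⟨q, rfl⟩ : ∃ q, p = q + 1 := ⟨p - 1, by omega⟩
  have hq : 1 ≤ q := by omega
  have hY : (2 : ℚ) ≤ 2 ^ q := by
    calc (2 : ℚ) = 2 ^ 1 := (pow_one 2).symm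
      _ ≤ 2 ^ q := pow_le_pow_right₀ (by norm_num) hq
  have hW : (0 : ℚ) < 2 ^ e₀ := zpow_pos (by norm_num) _
  have hY1 : (1 : ℚ) ≤ 2 ^ q := le_trans (by norm_num) hY
  have hY3 : (2 : ℚ) ^ q ≤ (2 ^ q) ^ 3 := le_self_pow₀ hY1 (by norm_num)
  have hY23 : ((2 : ℚ) ^ q) ^ 2 ≤ (2 ^ q) ^ 3 := pow_le_pow_right₀ hY1 (by norm_num)
  have hYsq : (2 : ℚ) * 2 ^ q ≤ (2 ^ q) ^ 2 := by nlinarith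
  have hapos : (0 : ℚ) < 2 * 2 ^ q - 1 := by linarith
  have hbpos : (0 : ℚ) < (2 * 2 ^ q - 1) * (4 * 2 ^ q) := mul_pos hapos (by positivity)
  have ha' : |a| = (2 * 2 ^ q - 1) * 2 ^ e₀ := by
    rw [ha, show -((2 : ℚ) ^ (q + 1) - 1) * 2 ^ e₀ = -((2 * 2 ^ q - 1) * 2 ^ e₀) by ring,
      abs_neg, abs_of_pos (mul_pos hapos hW)]
  have hb' : |b| = (2 * 2 ^ q - 1) * (4 * 2 ^ q) * 2 ^ e₀ := by
    rw [hb, show -(((2 : ℚ) ^ (q + 1) - 1) * 2 ^ (q + 1 + 1)) * 2 ^ e₀ =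
      -((2 * 2 ^ q - 1) * (4 * 2 ^ q) * 2 ^ e₀) by ring, abs_neg, abs_of_pos (mul_pos hbpos hW)]
  have hc' : |c| = 16 * (2 ^ q) ^ 3 * 2 ^ e₀ := by
    rw [hc, show -(2 : ℚ) ^ (3 * (q + 1) + 1) * 2 ^ e₀ = -(16 * (2 ^ q) ^ 3 * 2 ^ e₀) by ring,
      abs_neg, abs_of_pos (by positivity)]
  -- the three grids
  have gb : OnGrid (e₀ + ((q + 2 : ℕ) : ℤ)) b :=
    ⟨-(2 ^ (q + 1) - 1), by rw [hb, two_zpow_add_nat]; push_cast; ring⟩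
  have gc : OnGrid (e₀ + ((3 * q + 4 : ℕ) : ℤ)) c :=
    ⟨-1, by rw [hc, two_zpow_add_nat]; push_cast; ring⟩
  have gd : OnGrid (e₀ + ((3 * q + 5 : ℕ) : ℤ)) d :=
    ⟨2 ^ q + 1, by rw [hd, two_zpow_add_nat]; push_cast; ring⟩
  have sb : (2 : ℚ) ^ (e₀ + ((q + 2 : ℕ) : ℤ)) = 4 * 2 ^ q * 2 ^ e₀ := by
    rw [two_zpow_add_nat]; ring
  have sc : (2 : ℚ) ^ (e₀ + ((3 * q + 4 : ℕ) : ℤ)) = 16 * (2 ^ q) ^ 3 * 2 ^ e₀ := by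
    rw [two_zpow_add_nat]; ring
  have sd : (2 : ℚ) ^ (e₀ + ((3 * q + 5 : ℕ) : ℤ)) = 32 * (2 ^ q) ^ 3 * 2 ^ e₀ := by
    rw [two_zpow_add_nat]; ring
  have hab : Below 1 a b :=
    ⟨_, gb, by rw [one_mul, ha', sb]; exact mul_lt_mul_of_pos_right (by linarith) hW⟩
  have hac : Below 1 a c :=
    ⟨_, gc, by rw [one_mul, ha', sc]; exact mul_lt_mul_of_pos_right (by linarith) hW⟩
  have had : Below 1 a d :=
    ⟨_, gd, by rw [one_mul, ha', sd]; exact mul_lt_mul_of_pos_right (by linarith) hW⟩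
  have hbc : Below 1 b c :=
    ⟨_, gc, by rw [one_mul, hb', sc]; exact mul_lt_mul_of_pos_right (by nlinarith) hW⟩
  have hbd : Below 1 b d :=
    ⟨_, gd, by rw [one_mul, hb', sd]; exact mul_lt_mul_of_pos_right (by nlinarith) hW⟩
  have hcd : Below 1 c d :=
    ⟨_, gd, by rw [one_mul, hc', sd]; exact mul_lt_mul_of_pos_right (by nlinarith) hW⟩
  refine List.Pairwise.cons ?_ (List.Pairwise.cons ?_ (List.Pairwise.cons ?_
    (List.pairwise_singleton _ _)))
  · intro y hy
    simp only [List.mem_cons, List.mem_nil_iff, or_false] at hy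
    rcases hy with rfl | rfl | rfl
    exacts [hab, hac, had]
  · intro y hy
    simp only [List.mem_cons, List.mem_nil_iff, or_false] at hy
    rcases hy with rfl | rfl
    exacts [hbc, hbd]
  · intro y hy
    simp only [List.mem_cons, List.mem_nil_iff, or_false] at hy
    subst hy
    exact hcd

/-- For `p = 3`, `e₀ = 0` the family is the instance `⟨−7, −112, −1024, 10240⟩` of
`CompressRelativeErrorTiesAway.lean`. [cite: Shewchuk1997, §2.7 p. 333] -/
example : (-(2 ^ 3 - 1) * 2 ^ (0 : ℤ) : ℚ) = -7 ∧ (-((2 ^ 3 - 1) * 2 ^ (3 + 1)) * 2 ^ (0 : ℤ) : ℚ) = -112 ∧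
    (-2 ^ (3 * 3 + 1) * 2 ^ (0 : ℤ) : ℚ) = -1024 ∧ ((2 ^ 3 + 2) * 2 ^ (3 * 3 + 1) * 2 ^ (0 : ℤ) : ℚ) = 10240 := by
  norm_num

/-- **Ties-to-away counterexample to the relative reading of the p.333 conjecture, every precision.**
For `p ≥ 2`, `emin ≤ e₀`, every round-to-nearest `fl` on `F(p, emin)` with the IEEE 754-2008 attribute
roundTiesToAway (`IsTiesAway`), and the four floats `a, b, c, d` of the family (a nonoverlapping
expansion, `tiesAway_family_isFloat` / `tiesAway_family_isExpansion`): COMPRESS returns `[a, b, c, d]`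
unchanged, and the largest component `d` approximates the sum with RELATIVE error `> 2^-p` — more than
every member `1 + ε + ⋯ + ε^k` (`ε = 2^-p`) of Shewchuk's conjectured extremal family, whose relative
errors stay `< ε`. [cite: Shewchuk1997, §2.7 p. 333 (conjecture after Theorem 23);
RumpZimmermannBoldoMelquiond2009, §2.2 ("'ties to away' as defined by IEEE 754-2008");
BoldoEtAl2023, §2.1–2.2] -/
theorem compress_relative_error_tiesAway_all_prec (hp : 2 ≤ p) {e₀ : ℤ} (he : emin ≤ e₀)
    (hfl : IsRoundNearest p emin fl) (haway : IsTiesAway p emin fl) {a b c d : ℚ}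
    (ha : a = -(2 ^ p - 1) * 2 ^ e₀) (hb : b = -((2 ^ p - 1) * 2 ^ (p + 1)) * 2 ^ e₀)
    (hc : c = -2 ^ (3 * p + 1) * 2 ^ e₀) (hd : d = (2 ^ p + 2) * 2 ^ (3 * p + 1) * 2 ^ e₀) :
    compress fl [a, b, c, d] = [a, b, c, d] ∧
      ((2 : ℚ) ^ p)⁻¹ < |a + b + c + d - d| / |a + b + c + d| := by
  obtain ⟨Fa, Fb, Fc, Fd⟩ := tiesAway_family_isFloat hp he ha hb hc hd
  obtain ⟨q, rfl⟩ : ∃ q, p = q + 1 := ⟨p - 1, by omega⟩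
  have hq : 1 ≤ q := by omega
  have hY : (2 : ℚ) ≤ 2 ^ q := by
    calc (2 : ℚ) = 2 ^ 1 := (pow_one 2).symm
      _ ≤ 2 ^ q := pow_le_pow_right₀ (by norm_num) hq
  have hW : (0 : ℚ) < 2 ^ e₀ := zpow_pos (by norm_num) _
  have hYW : 0 < (2 : ℚ) ^ q * 2 ^ e₀ := by positivity
  -- the components over `Y = 2^q`, `W = 2^e₀`
  have ha' : a = -(2 * 2 ^ q - 1) * 2 ^ e₀ := by rw [ha]; ring
  have hb' : b = -((2 * 2 ^ q - 1) * (4 * 2 ^ q)) * 2 ^ e₀ := by rw [hb]; ring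
  have hc' : c = -(16 * (2 ^ q) ^ 3) * 2 ^ e₀ := by rw [hc]; ring
  have hd' : d = (32 * (2 ^ q) ^ 4 + 32 * (2 ^ q) ^ 3) * 2 ^ e₀ := by rw [hd]; ring
  have ha0 : a < 0 := by rw [ha']; nlinarith
  have hb0 : b < 0 := by rw [hb']; nlinarith
  have hc0 : c < 0 := by rw [hc']; nlinarith [pow_pos hYW 2]
  -- (1) the tie `fl(d + c) = d`: `d + c` is the midpoint of `f = d − u = 32Y⁴W` and `d = f + u`
  obtain ⟨f, hf⟩ : ∃ f : ℚ, f = 32 * (2 ^ q) ^ 4 * 2 ^ e₀ := ⟨_, rfl⟩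
  have hk₁ : e₀ + ((4 * q + 5 : ℕ) : ℤ) - ((q + 1 : ℕ) : ℤ) + 1 = e₀ + ((3 * q + 5 : ℕ) : ℤ) := by
    push_cast; ring
  have hu : (2 : ℚ) ^ (e₀ + ((3 * q + 5 : ℕ) : ℤ)) = 32 * (2 ^ q) ^ 3 * 2 ^ e₀ := by
    rw [two_zpow_add_nat]; ring
  have hfE : (2 : ℚ) ^ (e₀ + ((4 * q + 5 : ℕ) : ℤ)) = f := by rw [hf, two_zpow_add_nat]; ring
  have hfd : f + (2 : ℚ) ^ (e₀ + ((3 * q + 5 : ℕ) : ℤ)) = d := by rw [hu, hf, hd']; ring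
  have hYZ : (2 : ℤ) ≤ 2 ^ q := by
    calc (2 : ℤ) = 2 ^ 1 := (pow_one 2).symm
      _ ≤ 2 ^ q := pow_le_pow_right₀ (by norm_num) hq
  have Ff : IsFloat (q + 1) emin f :=
    ⟨1, e₀ + ((4 * q + 5 : ℕ) : ℤ), by rw [abs_one, pow_succ]; linarith, by push_cast; omega,
      by rw [← hfE]; simp⟩
  have hsucc : IsSucc (q + 1) emin f (f + (2 : ℚ) ^ (e₀ + ((3 * q + 5 : ℕ) : ℤ))) :=
    isSucc_of_grid hk₁ (by rw [hfd]; exact Fd) ⟨2 ^ q, by rw [hu, hf]; push_cast; ring⟩ hfE.le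
  have hdc : fl (d + c) = d := by
    have h := fl_midpoint_of_tiesAway_nonneg hfl haway Ff hsucc (by rw [hf]; positivity)
    rwa [hfd, show (f + d) / 2 = d + c by rw [hf, hd', hc']; ring] at h
  -- (2) `fl(c + b) = c`: grid `16Y²W` beyond `|c| = 16Y³W = 2^E`, `|b| < 8Y²W`
  have hk₂ : e₀ + ((3 * q + 4 : ℕ) : ℤ) - ((q + 1 : ℕ) : ℤ) + 1 = e₀ + ((2 * q + 4 : ℕ) : ℤ) := by
    push_cast; ring
  have hg₂ : (2 : ℚ) ^ (e₀ + ((2 * q + 4 : ℕ) : ℤ)) = 16 * (2 ^ q) ^ 2 * 2 ^ e₀ := by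
    rw [two_zpow_add_nat]; ring
  have hE₂ : (2 : ℚ) ^ (e₀ + ((3 * q + 4 : ℕ) : ℤ)) = 16 * (2 ^ q) ^ 3 * 2 ^ e₀ := by
    rw [two_zpow_add_nat]; ring
  have hcb : fl (c + b) = c :=
    fl_eq_of_grid hfl hk₂ Fc ⟨-(2 ^ q), by rw [hg₂, hc']; push_cast; ring⟩
      (le_of_eq (by rw [hE₂, hc']; ring)) (by linarith)
      (by rw [hg₂, hb']; nlinarith [hYW])
  -- (3) `fl(b + a) = b`: grid `4YW` beyond `4Y²W = 2^E ≤ |b|`, `|a| < 2YW`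
  have hk₃ : e₀ + ((2 * q + 2 : ℕ) : ℤ) - ((q + 1 : ℕ) : ℤ) + 1 = e₀ + ((q + 2 : ℕ) : ℤ) := by
    push_cast; ring
  have hg₃ : (2 : ℚ) ^ (e₀ + ((q + 2 : ℕ) : ℤ)) = 4 * 2 ^ q * 2 ^ e₀ := by
    rw [two_zpow_add_nat]; ring
  have hE₃ : (2 : ℚ) ^ (e₀ + ((2 * q + 2 : ℕ) : ℤ)) = 4 * (2 ^ q) ^ 2 * 2 ^ e₀ := by
    rw [two_zpow_add_nat]; ring
  have hbE : b ≤ -(2 : ℚ) ^ (e₀ + ((2 * q + 2 : ℕ) : ℤ)) := by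
    have h1 : (4 : ℚ) * (2 ^ q) ^ 2 ≤ (2 * 2 ^ q - 1) * (4 * 2 ^ q) := by nlinarith
    have h2 := mul_le_mul_of_nonneg_right h1 hW.le
    rw [hE₃, hb']
    linarith
  have hba : fl (b + a) = b :=
    fl_eq_of_grid hfl hk₃ Fb ⟨-(2 ^ (q + 1) - 1), by rw [hg₃, hb']; push_cast; ring⟩
      hbE (by linarith) (by rw [hg₃, ha']; nlinarith [hW])
  refine ⟨compress_eq_self_of_roundings (fl_eq_self hfl (isFloat_zero _ _)) (fl_eq_self hfl Fa)
    (fl_eq_self hfl Fb) (fl_eq_self hfl Fc) hdc hcb hba ha0.ne hb0.ne hc0.ne, ?_⟩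
  -- (4) the relative error `E/S` with `E = 16Y³ + 8Y² − 2Y − 1`, `S = 32Y⁴ + 16Y³ − 8Y² + 2Y + 1`:
  -- `E/S > 1/(2Y)` because `2Y·E − S = 4Y² − 4Y − 1 > 0` for `Y ≥ 2`.
  have hY1 : (1 : ℚ) ≤ 2 ^ q := le_trans (by norm_num) hY
  have hY3 : (2 : ℚ) ^ q ≤ (2 ^ q) ^ 3 := le_self_pow₀ hY1 (by norm_num)
  have hY2 : (2 : ℚ) ^ q ≤ (2 ^ q) ^ 2 := le_self_pow₀ hY1 (by norm_num)
  have hY24 : ((2 : ℚ) ^ q) ^ 2 ≤ (2 ^ q) ^ 4 := pow_le_pow_right₀ hY1 (by norm_num)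
  have hErr : a + b + c + d - d =
      -((16 * (2 ^ q) ^ 3 + 8 * (2 ^ q) ^ 2 - 2 * 2 ^ q - 1) * 2 ^ e₀) := by
    rw [ha', hb', hc']; ring
  have hSum : a + b + c + d =
      (32 * (2 ^ q) ^ 4 + 16 * (2 ^ q) ^ 3 - 8 * (2 ^ q) ^ 2 + 2 * 2 ^ q + 1) * 2 ^ e₀ := by
    rw [ha', hb', hc', hd']; ring
  have hEpos : (0 : ℚ) < 16 * (2 ^ q) ^ 3 + 8 * (2 ^ q) ^ 2 - 2 * 2 ^ q - 1 := by linarith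
  have hSpos : (0 : ℚ) < 32 * (2 ^ q) ^ 4 + 16 * (2 ^ q) ^ 3 - 8 * (2 ^ q) ^ 2 + 2 * 2 ^ q + 1 := by
    linarith
  rw [hErr, hSum, abs_neg, abs_of_pos (mul_pos hEpos hW), abs_of_pos (mul_pos hSpos hW),
    mul_div_mul_right _ _ hW.ne', pow_succ, lt_div_iff₀ hSpos,
    inv_mul_lt_iff₀ (by positivity : (0 : ℚ) < 2 ^ q * 2)]
  have hgap : (0 : ℚ) < 4 * (2 ^ q) ^ 2 - 4 * 2 ^ q - 1 := by nlinarith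
  have hid : (2 : ℚ) ^ q * 2 * (16 * (2 ^ q) ^ 3 + 8 * (2 ^ q) ^ 2 - 2 * 2 ^ q - 1) -
      (32 * (2 ^ q) ^ 4 + 16 * (2 ^ q) ^ 3 - 8 * (2 ^ q) ^ 2 + 2 * 2 ^ q + 1) =
      4 * (2 ^ q) ^ 2 - 4 * 2 ^ q - 1 := by
    ring
  rw [← hid] at hgap
  exact sub_pos.mp hgap

end Summit.Ventures.CertifiedArithmetic.Expansions
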